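import Summits.Parity.BatemanHorn.Theorems.SoloInformedThinCounting
import Mathlib.Analysis.SpecialFunctions.Pow.Asymptotics
import HarnessLib

/-!
# Thin sequences vs. Type-I/II information, IV: Type-I level at most the density

Part of the `SoloInformedThin*` series (`…Counting`, `…TypeII`, `…TypeIIVoid`, `…TypeI`,
`…Polynomial`), which turns Ford–Maynard's heuristic remark (arXiv:2407.14368, §2.4: for the
normalised indicator of a set `𝒥 ⊆ (x/2, x]` with `x^{1-c}` elements "one can only hope for (I)
to hold for `γ < 1 − c` and (II) for `θ > c`") into theorems about EVERY real sequence with thin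
support, in the tree's exact formalisation `Literature.Barriers.Parity.FordMaynard.TypeI` /
`TypeII` (comparison sequence `b = 1`, `w = a − 1`).  The tree's barrier entry
`Literature.Barriers.Parity.FordMaynardLowLevel` flags the remark as "a HEURISTIC remark of the
paper, not a theorem about any specific thin set"; these files supply the theorem.

This file: the Type-I half.
* `typeI_sparse_le` — testing (I) (with `I(m) = [1, x]`) at the primes `M < p ≤ x^γ` of a set `S`:
  `∑_{p ∈ S} (x/(2p) − 1) − (#A · log x / log M) · x/(2M) ≤ x/(log x)^B`;
* `eventually_not_typeI_of_sparse` — for `0 < c ≤ 1`, `γ > 1 − c`, `B > 1` and all large `x`, NO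
  real sequence with at most `x^{1−c}` non-zero values on `(x/2, x]` has `w = a − 1` satisfying
  (I) at level `x^γ` (primes `p ∈ (M, 2M]`, `M ≍ x^{1−c'}`, `max(1−γ, 0) < c' < c`).

References: [cite: FordMaynard2024PrimeSieves, §2.4 (p. 7, first family and footnote)]
[cite: FordMaynard2024PrimeSieves, §1 (I)].
-/

noncomputable section

open Filter Finset Real

namespace Summit.Parity.BatemanHorn.Theorems

open Literature.Barriers.Parity.FordMaynard (TypeI eventually_mul_rpow_le_rpow)

/-- **(I) against a thin support.**  Let `S` be a finite set of primes `M < p ≤ x^γ` and let `A`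
contain the support of `a` on `(x/2, x]`.  If `w = a − 1` satisfies (I) at level `x^γ`, then
`∑_{p ∈ S} (x/(2p) − 1) − (#A · log x / log M) · x/(2M) ≤ x/(log x)^B`.
[cite: FordMaynard2024PrimeSieves, §2.4] -/
theorem typeI_sparse_le {a : ℕ → ℝ} {x γ B : ℝ} (hB : 0 ≤ B) (hx : 1 ≤ x) {M : ℝ}
    (hM : 1 < M) (S A : Finset ℕ)
    (hS : ∀ p ∈ S, p.Prime ∧ M < (p : ℝ) ∧ (p : ℝ) ≤ x ^ γ)
    (hA : ∀ v : ℕ, x / 2 < (v : ℝ) → (v : ℝ) ≤ x → a v ≠ 0 → v ∈ A)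
    (h : TypeI (fun n : ℕ => a n - 1) x γ B) :
    ∑ p ∈ S, (x / (2 * p) - 1) - A.card * (Real.log x / Real.log M) * (x / (2 * M))
      ≤ x / Real.log x ^ B := by
  set L := Real.log x / Real.log M with hL
  -- name the cofactor range first (keeps instance resolution for the filters below syntactic)
  set T : Finset ℕ := Icc 1 ⌊x⌋₊ with hTdef
  set Nw : ℕ → Finset ℕ := fun m : ℕ =>
    T.filter (fun n : ℕ => x / 2 < (m * n : ℝ) ∧ (m * n : ℝ) ≤ x) with hNw
  have key : ∑ m ∈ Icc 1 ⌊x ^ γ⌋₊, ((m.divisors.card : ℝ) ^ B) *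
      |∑ n ∈ Nw m, (a (m * n) - 1)| ≤ x / Real.log x ^ B := h (fun _ => (1, ⌊x⌋₊))
  -- bad primes `Sb` (some cofactor carries a non-zero value) and good primes `Sg`
  set Sb : Finset ℕ := S.filter (fun p : ℕ => ∃ r : ℕ, r ∈ T ∧
      (x / 2 < (p * r : ℝ) ∧ (p * r : ℝ) ≤ x) ∧ a (p * r) ≠ 0) with hSb
  set Sg : Finset ℕ := S.filter (fun p : ℕ => ¬ ∃ r : ℕ, r ∈ T ∧
      (x / 2 < (p * r : ℝ) ∧ (p * r : ℝ) ≤ x) ∧ a (p * r) ≠ 0) with hSg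
  have hS' : ∀ p ∈ S, p.Prime ∧ M < (p : ℝ) := fun p hp => ⟨(hS p hp).1, (hS p hp).2.1⟩
  have hSsub : S ⊆ Icc 1 ⌊x ^ γ⌋₊ := fun p hp => by
    rw [mem_Icc]; exact ⟨(hS p hp).1.one_le, Nat.le_floor (hS p hp).2.2⟩
  have hSgS : Sg ⊆ S := by rw [hSg]; exact filter_subset _ _
  have hSbS : Sb ⊆ S := by rw [hSb]; exact filter_subset _ _
  have hM0 : 0 < M := by linarith
  have hL0 : 0 ≤ L := div_nonneg (Real.log_nonneg hx) (Real.log_nonneg hM.le)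
  -- good primes: each contributes at least `x/(2p) - 1`
  have hgoodterm : ∀ p ∈ Sg, x / (2 * p) - 1 ≤
      ((p.divisors.card : ℝ) ^ B) * |∑ n ∈ Nw p, (a (p * n) - 1)| := by
    intro p hp
    have hp' := hp
    simp only [hSg, Finset.mem_filter] at hp'
    obtain ⟨hpS, hg⟩ := hp'
    have hpr := (hS p hpS).1
    have hp0 : 0 < p := hpr.pos
    have hzero : ∀ n ∈ Nw p, a (p * n) = 0 := by
      intro n hn
      have hn' := hn
      simp only [hNw, Finset.mem_filter] at hn'
      by_contra hne
      exact hg ⟨n, hn'.1, hn'.2, hne⟩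
    have hinner : ∑ n ∈ Nw p, (a (p * n) - 1) = -((Nw p).card : ℝ) := by
      rw [Finset.card_eq_sum_ones, Nat.cast_sum, ← Finset.sum_neg_distrib]
      refine sum_congr rfl fun n hn => ?_
      rw [hzero n hn]
      simp
    rw [hinner, abs_neg, Nat.abs_cast]
    have hcardpos : 0 < p.divisors.card :=
      Finset.card_pos.mpr ⟨1, Nat.one_mem_divisors.mpr hpr.ne_zero⟩
    have hτ1 : (1 : ℝ) ≤ (p.divisors.card : ℝ) := by exact_mod_cast hcardpos
    have hτ : (1 : ℝ) ≤ (p.divisors.card : ℝ) ^ B := Real.one_le_rpow hτ1 hB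
    have hsub1 : Ioc ⌊x / (2 * p)⌋₊ ⌊x / p⌋₊ ⊆ Nw p := by
      intro r hr
      obtain ⟨hr1, h1, h2⟩ := mem_Ioc_cofactor (by linarith) hp0 hr
      simp only [hNw, hTdef, Finset.mem_filter, mem_Icc]
      refine ⟨⟨hr1, Nat.le_floor ?_⟩, h1, h2⟩
      have hp1 : (1 : ℝ) ≤ p := by exact_mod_cast hp0
      have : (r : ℝ) ≤ p * r := le_mul_of_one_le_left (Nat.cast_nonneg _) hp1
      linarith
    have hN : x / (2 * p) - 1 ≤ ((Nw p).card : ℝ) :=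
      (sub_one_le_card_Ioc_cofactor (by linarith) hp0).trans
        (by exact_mod_cast card_le_card hsub1)
    exact hN.trans (le_mul_of_one_le_left (Nat.cast_nonneg _) hτ)
  have h1 : ∑ p ∈ Sg, (x / (2 * p) - 1) ≤ x / Real.log x ^ B :=
    calc ∑ p ∈ Sg, (x / (2 * p) - 1)
        ≤ ∑ p ∈ Sg, ((p.divisors.card : ℝ) ^ B) * |∑ n ∈ Nw p, (a (p * n) - 1)| :=
          sum_le_sum hgoodterm
      _ ≤ ∑ m ∈ Icc 1 ⌊x ^ γ⌋₊, ((m.divisors.card : ℝ) ^ B) *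
            |∑ n ∈ Nw m, (a (m * n) - 1)| :=
          sum_le_sum_of_subset_of_nonneg (hSgS.trans hSsub)
            (fun m _ _ => mul_nonneg (Real.rpow_nonneg (Nat.cast_nonneg _) _) (abs_nonneg _))
      _ ≤ x / Real.log x ^ B := key
  -- bad primes: at most `#A · L` of them, each term at most `x/(2M)`
  have h2 : (Sb.card : ℝ) ≤ A.card * L :=
    card_badPrimes_le hx hM S T A Sb hS' hA (fun p hp => by
      have hp' := hp
      simp only [hSb, Finset.mem_filter] at hp'
      exact hp')
  have h3 : ∑ p ∈ Sb, (x / (2 * p) - 1) ≤ Sb.card * (x / (2 * M)) := by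
    rw [← nsmul_eq_mul, ← sum_const]
    refine sum_le_sum fun p hp => ?_
    have hMp := (hS p (hSbS hp)).2.1
    have hp0 : (0 : ℝ) < p := by linarith
    have : x / (2 * p) ≤ x / (2 * M) :=
      div_le_div_of_nonneg_left (by linarith) (by positivity) (by linarith)
    linarith
  have hsplit : ∑ p ∈ Sb, (x / (2 * p) - 1) + ∑ p ∈ Sg, (x / (2 * p) - 1) =
      ∑ p ∈ S, (x / (2 * p) - 1) := by
    rw [hSb, hSg]
    exact sum_filter_add_sum_filter_not S _ _
  have h4 : (Sb.card : ℝ) * (x / (2 * M)) ≤ A.card * L * (x / (2 * M)) :=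
    mul_le_mul_of_nonneg_right h2 (by positivity)
  linarith

/-- **No Type-I information above the density.**  Let `0 < c ≤ 1`, `γ > 1 − c`, `B > 1`.  For
all large `x`: no real sequence with at most `x^{1−c}` non-zero values on `(x/2, x]` has
`w = a − 1` satisfying (I) at level `x^γ`. [cite: FordMaynard2024PrimeSieves, §2.4] -/
theorem eventually_not_typeI_of_sparse {c γ B : ℝ} (hc : 0 < c) (hc1 : c ≤ 1) (hγ : 1 - c < γ)
    (hB : 1 < B) :
    ∀ᶠ x : ℝ in atTop, ∀ (a : ℕ → ℝ) (A : Finset ℕ), (A.card : ℝ) ≤ x ^ (1 - c) →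
      (∀ v : ℕ, x / 2 < (v : ℝ) → (v : ℝ) ≤ x → a v ≠ 0 → v ∈ A) →
      ¬ TypeI (fun n : ℕ => a n - 1) x γ B := by
  obtain ⟨K, hK1, hK⟩ := exists_card_primes_Ioc_two_mul_ge
  have hK0 : 0 < K := by linarith
  -- the scale `M ≍ x^(1 - c')` with `max(1-γ, 0) < c' < c`
  have hmax0 : (0 : ℝ) ≤ max (1 - γ) 0 := le_max_right _ _
  have hmax1 : 1 - γ ≤ max (1 - γ) 0 := le_max_left _ _
  have hmaxc : max (1 - γ) 0 < c := max_lt (by linarith) hc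
  set c' : ℝ := (max (1 - γ) 0 + c) / 2 with hc'def
  have hc'c : c' < c := by rw [hc'def]; linarith
  have hc'0 : 0 < c' := by rw [hc'def]; linarith
  have hc'1 : c' < 1 := by rw [hc'def]; linarith
  have hc'γ : 1 - c' < γ := by rw [hc'def]; linarith
  have hcc' : c < 5 * c' := by rw [hc'def]; linarith
  have hδ : 0 < (c - c') / 4 := by linarith
  filter_upwards [eventually_ge_atTop (4 : ℝ),
    eventually_mul_rpow_le_rpow 6 hc'γ,
    eventually_mul_rpow_le_rpow (48 * K) (by linarith : 1 - c' + (c - c') / 4 < 1),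
    eventually_mul_rpow_le_rpow (16 * K)
      (by linarith : 1 - c + c' + (c - c') / 4 + (c - c') / 4 < 1),
    (isLittleO_log_rpow_atTop hδ).bound one_pos,
    ((tendsto_rpow_atTop (by linarith : 0 < B - 1)).comp
      Real.tendsto_log_atTop).eventually_gt_atTop (8 * K)]
    with x hx4 e1 e2 e3 elog e4 a A hA hcov hI
  rw [Real.rpow_one] at e2 e3
  have hx0 : 0 < x := by linarith
  have hx1 : 1 ≤ x := by linarith
  have hlx : 0 ≤ Real.log x := Real.log_nonneg hx1
  have hlx1 : 1 ≤ Real.log x := by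
    rw [Real.le_log_iff_exp_le hx0]
    have := Real.exp_one_lt_d9
    linarith
  have hlx0 : 0 < Real.log x := by linarith
  have hlogle : Real.log x ≤ x ^ ((c - c') / 4) := by
    have := elog
    simp only [one_mul, Real.norm_eq_abs] at this
    rwa [abs_of_nonneg hlx, abs_of_nonneg (Real.rpow_nonneg hx0.le _)] at this
  have e4' : 8 * K < Real.log x ^ (B - 1) := by simpa using e4
  set M : ℕ := ⌊x ^ (1 - c')⌋₊ + 2 with hMdef
  have hM2 : 2 ≤ M := by omega
  have hM2r : (2 : ℝ) ≤ M := by exact_mod_cast hM2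
  have hM0 : (0 : ℝ) < M := by linarith
  have hMlow : x ^ (1 - c') < M := by
    have := Nat.lt_floor_add_one (x ^ (1 - c'))
    push_cast [hMdef]
    linarith
  have hx1c : 1 ≤ x ^ (1 - c') := Real.one_le_rpow hx1 (by linarith)
  have hMle : (M : ℝ) ≤ 3 * x ^ (1 - c') := by
    have h1 : (⌊x ^ (1 - c')⌋₊ : ℝ) ≤ x ^ (1 - c') := Nat.floor_le (Real.rpow_nonneg hx0.le _)
    push_cast [hMdef]
    linarith
  set S : Finset ℕ := (Ioc M (2 * M)).filter Nat.Prime with hSdef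
  have hSprop : ∀ p ∈ S, p.Prime ∧ (M : ℝ) < p ∧ (p : ℝ) ≤ x ^ γ := by
    intro p hp
    rw [hSdef, mem_filter, mem_Ioc] at hp
    obtain ⟨⟨hMp, hp2M⟩, hpr⟩ := hp
    have hMp' : (M : ℝ) < p := by exact_mod_cast hMp
    have hp2M' : (p : ℝ) ≤ 2 * M := by exact_mod_cast hp2M
    exact ⟨hpr, hMp', by linarith⟩
  have hmain := typeI_sparse_le (by linarith) hx1 (by linarith : (1 : ℝ) < M) S A hSprop hcov hI
  have hL : Real.log x / Real.log M ≤ 2 * Real.log x := by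
    have hlogM : Real.log 2 ≤ Real.log M := Real.log_le_log two_pos hM2r
    have hl2 := Real.log_two_gt_d9
    rw [div_le_iff₀ (by linarith)]
    nlinarith
  have hcardS := hK M (by omega)
  -- `x^(1-c') ≤ K x^(1-c'+δ)` and hence `4M ≤ x`
  have hxδ : 1 ≤ x ^ ((c - c') / 4) := Real.one_le_rpow hx1 hδ.le
  have hxK : x ^ (1 - c') ≤ K * x ^ (1 - c' + (c - c') / 4) := by
    rw [Real.rpow_add hx0]
    have h1 : x ^ (1 - c') ≤ x ^ (1 - c') * x ^ ((c - c') / 4) :=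
      le_mul_of_one_le_right (Real.rpow_nonneg hx0.le _) hxδ
    have h2 : x ^ (1 - c') * x ^ ((c - c') / 4) ≤ K * (x ^ (1 - c') * x ^ ((c - c') / 4)) :=
      le_mul_of_one_le_left (by positivity) hK1
    linarith
  have h4Mx : 4 * (M : ℝ) ≤ x := by linarith
  have hsum : (S.card : ℝ) * (x / (4 * M) - 1) ≤ ∑ p ∈ S, (x / (2 * p) - 1) := by
    rw [← nsmul_eq_mul, ← sum_const]
    refine sum_le_sum fun p hp => ?_
    have hp2M : (p : ℝ) ≤ 2 * M := by
      have := hp; rw [hSdef, mem_filter, mem_Ioc] at this; exact_mod_cast this.1.2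
    have hp0 : (0 : ℝ) < p := by exact_mod_cast (hSprop p hp).1.pos
    have : x / (4 * M) ≤ x / (2 * p) :=
      div_le_div_of_nonneg_left hx0.le (by positivity) (by linarith)
    linarith
  -- `#S (x/(4M) - 1) ≥ x/(4 K log x) - M`
  have h2Mx : 2 * (M : ℝ) ≤ x := by linarith
  have hlog2M0 : 0 < Real.log (2 * M) := Real.log_pos (by linarith)
  have hlog2M : Real.log (2 * M) ≤ Real.log x := Real.log_le_log (by positivity) h2Mx
  have hKl0 : 0 < K * Real.log (2 * M) := mul_pos hK0 hlog2M0
  have hSlow : x / (4 * K * Real.log x) - M ≤ (S.card : ℝ) * (x / (4 * M) - 1) := by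
    have hpos : 0 ≤ x / (4 * M) - 1 := by
      rw [sub_nonneg, le_div_iff₀ (by positivity)]; linarith
    have h1 : (M : ℝ) / (K * Real.log (2 * M)) * (x / (4 * M) - 1) ≤
        (S.card : ℝ) * (x / (4 * M) - 1) := mul_le_mul_of_nonneg_right hcardS hpos
    have hMne : (M : ℝ) ≠ 0 := hM0.ne'
    have hKne : K ≠ 0 := hK0.ne'
    have hlne : Real.log (2 * M) ≠ 0 := hlog2M0.ne'
    have h2 : (M : ℝ) / (K * Real.log (2 * M)) * (x / (4 * M) - 1) =
        x / (4 * K * Real.log (2 * M)) - M / (K * Real.log (2 * M)) := by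
      field_simp
    have h3 : x / (4 * K * Real.log x) ≤ x / (4 * K * Real.log (2 * M)) :=
      div_le_div_of_nonneg_left hx0.le (by positivity)
        (mul_le_mul_of_nonneg_left hlog2M (by positivity))
    have h4 : (M : ℝ) / (K * Real.log (2 * M)) ≤ M := by
      rw [div_le_iff₀ hKl0]
      have hl4 : Real.log 4 ≤ Real.log (2 * M) := Real.log_le_log (by norm_num) (by linarith)
      have hl4' : 1 ≤ Real.log 4 := by
        rw [Real.le_log_iff_exp_le (by norm_num)]
        have := Real.exp_one_lt_d9
        linarith
      have hKl1 : 1 ≤ K * Real.log (2 * M) := one_le_mul_of_one_le_of_one_le hK1 (by linarith)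
      exact le_mul_of_one_le_right hM0.le hKl1
    linarith only [h1, h2, h3, h4]
  -- the subtracted Type-I term: `#A L x/(2M) ≤ x^(1-c) · 2 log x · x^{c'}/2 ≤ x/(16 K log x)`
  have hsubtr : (A.card : ℝ) * (Real.log x / Real.log M) * (x / (2 * M)) ≤
      x / (16 * K * Real.log x) := by
    have hxc' : x ^ (1 - c') * x ^ c' = x := by
      rw [← Real.rpow_add hx0]; norm_num
    have s2 : x / (2 * M) ≤ x ^ c' / 2 := by
      rw [div_le_div_iff₀ (by positivity) two_pos]
      have : x ≤ M * x ^ c' :=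
        calc x = x ^ (1 - c') * x ^ c' := hxc'.symm
          _ ≤ M * x ^ c' := mul_le_mul_of_nonneg_right hMlow.le (Real.rpow_nonneg hx0.le _)
      linarith
    have s1 : (A.card : ℝ) * (Real.log x / Real.log M) * (x / (2 * M)) ≤
        (x ^ (1 - c) * (2 * Real.log x)) * (x ^ c' / 2) :=
      mul_le_mul (mul_le_mul hA hL (div_nonneg hlx (Real.log_nonneg (by linarith)))
        (Real.rpow_nonneg hx0.le _)) s2 (by positivity) (by positivity)
    have s3 : (x ^ (1 - c) * (2 * Real.log x)) * (x ^ c' / 2) =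
        x ^ (1 - c + c') * Real.log x := by
      rw [Real.rpow_add hx0]; ring
    have hprod : x ^ (1 - c + c') * x ^ ((c - c') / 4) * x ^ ((c - c') / 4) =
        x ^ (1 - c + c' + (c - c') / 4 + (c - c') / 4) := by
      rw [← Real.rpow_add hx0, ← Real.rpow_add hx0]
    have s4 : x ^ (1 - c + c') * Real.log x * Real.log x ≤
        x ^ (1 - c + c') * x ^ ((c - c') / 4) * x ^ ((c - c') / 4) := by
      have hnn : 0 ≤ x ^ (1 - c + c') := Real.rpow_nonneg hx0.le _
      exact mul_le_mul (mul_le_mul_of_nonneg_left hlogle hnn) hlogle hlx (by positivity)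
    rw [hprod] at s4
    have s5 : x ^ (1 - c + c') * Real.log x ≤ x / (16 * K * Real.log x) := by
      rw [le_div_iff₀ (by positivity)]
      have : x ^ (1 - c + c') * Real.log x * (16 * K * Real.log x) =
          16 * K * (x ^ (1 - c + c') * Real.log x * Real.log x) := by ring
      rw [this]
      have := mul_le_mul_of_nonneg_left s4 (by positivity : (0 : ℝ) ≤ 16 * K)
      linarith
    calc _ ≤ (x ^ (1 - c) * (2 * Real.log x)) * (x ^ c' / 2) := s1
      _ = x ^ (1 - c + c') * Real.log x := s3
      _ ≤ _ := s5
  have hMsmall : (M : ℝ) ≤ x / (16 * K * Real.log x) := by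
    rw [le_div_iff₀ (by positivity)]
    have hnn : 0 ≤ x ^ (1 - c') := Real.rpow_nonneg hx0.le _
    have h1 : x ^ (1 - c') * Real.log x ≤ x ^ (1 - c' + (c - c') / 4) := by
      rw [Real.rpow_add hx0]; exact mul_le_mul_of_nonneg_left hlogle hnn
    have h2 : (M : ℝ) * (16 * K * Real.log x) ≤ 3 * x ^ (1 - c') * (16 * K * Real.log x) :=
      mul_le_mul_of_nonneg_right hMle (by positivity)
    have h3 : 3 * x ^ (1 - c') * (16 * K * Real.log x) =
        48 * K * (x ^ (1 - c') * Real.log x) := by ring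
    have h4 : 48 * K * (x ^ (1 - c') * Real.log x) ≤ 48 * K * x ^ (1 - c' + (c - c') / 4) :=
      mul_le_mul_of_nonneg_left h1 (by positivity)
    linarith
  have hfin := div_log_rpow_lt hK0 (by linarith) e4'
  -- assemble: `x/(4K log x) − M − x/(16 K log x) ≤ main ≤ x/(log x)^B < x/(8 K log x)`
  have hid : x / (4 * K * Real.log x) - x / (16 * K * Real.log x) - x / (16 * K * Real.log x) =
      x / (8 * K * Real.log x) := by
    have hlxne : Real.log x ≠ 0 := hlx0.ne'
    have hKne : K ≠ 0 := hK0.ne'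
    field_simp
    ring
  linarith only [hmain, hsum, hSlow, hsubtr, hMsmall, hfin, hid]

end Summit.Parity.BatemanHorn.Theorems

end
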